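import Summits.BirchSwinnertonDyer.Rank1Residual.X11b.BDPRouteSelmerFiniteRankOne

/-! # Route `CongruentShaFreeCut` (rung S2) — crux `RankPosOfTwoSelmerCorankOne`
(stmt-BirchSwinnertonDyer-19079, the route's declared RESIDUAL), Link A in CORANK currency, part 1/3:
RELAXING THE SELMER CONDITION AT ONE PLACE COSTS AT MOST THE INDEX OF THE SELMER GROUP'S OWN LOCAL IMAGE
(Poitou–Tate, no Mordell–Weil point), and the counting that bounds that index by the torsion-valued part

Cell `bsd-cn100`, prover seat `bsd-cn100-transfer-2` g3. Supports, does not close,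
stmt-BirchSwinnertonDyer-19079 (registered stub `stub_twoAdicControlOfCorankOne`, line of record
`heegner-field-links` v3; the named Prop `Theorems/CongruentShaFreeCutTwoAdicLinksCorank.TwoAdicControlOfCorankOne`,
p425532). HONEST FRAMING: generic Galois-cohomology bookkeeping for ANY elliptic curve over a number
field; §1 is CONDITIONAL (label B) on a Poitou–Tate family (`IsPerfect`, `SumLocalTermEqZero` — the
content of the textbook named fact `poitouTate_sum_localTatePairing_eq_zero`, Milne ADT I Thm. 4.10(b)
with Cor. 2.3) and on the local Euler–Poincaré count (`localEulerPoincareCharacteristic`, Milne I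
Thm. 2.8), both hypotheses; nothing about BSD, crux A, crux B or the leaf is claimed. Companion of the
cell's rank-currency closure of Link A (s2-c3 g3, `Theorems/CongruentShaFreeCutTwoAdicSelmerFinite.lean`,
p429679), which needs a point of infinite order; the point of this series (parts 1–3:
`…TwoAdicSelmerLocIndex`, `…TwoAdicSelmerCorankSupplies`, `…TwoAdicSelmerFiniteCorank`) is to reach
the same finiteness of Castella's `Sel_𝔭(K, E[p^∞])` in CORANK currency, modulo an explicit VISIBILITY
hypothesis (the honest residue of a `p`-converse beyond the rank-one case).

## What is proved

* §1 `relIndex_selmerGroup_kummerOutside_le_locIndex[_of_facts]` — the duality half of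
  Jetchev–Skinner–Wan 2017 Prop. 3.2.1 (`≤`) with the image of the GLOBAL POINTS replaced by the image
  of the WHOLE SELMER GROUP: `[H¹_{𝓛, ⊤ at v₀}(K, E[n]) : Sel⁽ⁿ⁾(E/K)] ≤ [𝓛_{v₀} : loc_{v₀} Sel⁽ⁿ⁾(E/K)]`
  (reciprocity between a class relaxed at `v₀` and a Selmer class: every other local term of the
  Poitou–Tate sum vanishes by isotropy; then the annihilator count `#N·#loc(Sel) = #H¹(K_{v₀},E[n]) =
  #𝓛²`). The X11b original (`Relaxation.relIndex_selmerGroup_kummerOutside_le`, b2b cell) bounds by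
  `[E(K_{v₀}) : nE(K_{v₀}) + im E(K)]`, which is unbounded in the level when `rank E(K) = 0`.
* §2 `locIndex_le_of_torsionValued_of_card` — `[𝓛_𝔮 : loc_𝔮 Sel⁽ⁿ⁾] ≤ B₃·B₁` when the
  `𝔮`-TORSION-VALUED part `Sel⁽ⁿ⁾ ∩ loc_𝔮⁻¹ κ_𝔮(E(K_𝔮)_tors)` has order `≤ B₁` and `#𝓛_𝔮 ≤ B₃ · #Sel⁽ⁿ⁾`
  (pure counting: the kernel of `loc_𝔮` on `Sel` is torsion-valued).

References: [JetchevSkinnerWan2017] Prop. 3.2.1 (arXiv:1512.06894 pp. 10–11); [MilneADT2006] I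
Cor. 2.3, Thm. 2.8, Thm. 4.10(b), Lemma 6.15; [PoonenRains2012] Prop. 4.8; [Castella2018] (3.2.1). -/

noncomputable section

open scoped Classical

universe u

namespace Summit.BirchSwinnertonDyer.BirchSwinnertonDyer.Theorems.CongruentShaFreeCutTwoAdicSelmerLocIndex

open WeierstrassCurve NumberField IsDedekindDomain Field Function
open Literature.NumberTheory.EllipticCurves Literature.NumberTheory.EllipticCurves.GreenbergSelmer
open Literature.NumberTheory.GaloisRepresentations Literature.NumberTheory.GaloisCohomology
open Literature.NumberTheory.GaloisRepresentations.DiscreteGaloisModule (mu MuCarrier)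
open Summit.BirchSwinnertonDyer.Rank1Residual.X11b
open Summit.BirchSwinnertonDyer.Rank1Residual.X11b.FiniteDuality
open Summit.BirchSwinnertonDyer.Rank1Residual.X11b.Relaxation
open scoped ContRepresentation


/-! ## 1. Relaxing at one place costs at most the index of the SELMER GROUP'S OWN local image -/

section PartB

variable {K : Type u} [Field K] [NumberField K] (W : WeierstrassCurve K) [W.IsElliptic]
variable (n : ℕ) [NeZero n] (v₀ : HeightOneSpectrum (𝓞 K))

/-- **`[H¹_{𝓛, ⊤ at v₀}(K, E[n]) : Sel⁽ⁿ⁾(E/K)] ≤ [𝓛_{v₀} : loc_{v₀} Sel⁽ⁿ⁾(E/K)]`** — the duality half of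
Jetchev–Skinner–Wan 2017 Prop. 3.2.1 with the image of the GLOBAL POINTS replaced by the image of the
WHOLE Selmer group (so that no Mordell–Weil point is needed): given a Poitou–Tate family `inv`
(`IsPerfect`, `SumLocalTermEqZero`) and the count `#H¹(K_{v₀}, E[n]) = #𝓛_{v₀}²`, the quotient
`H¹_{𝓛,⊤ at v₀}/Sel` embeds by `loc_{v₀}` into `N/𝓛_{v₀}`, `N` the annihilator of `loc_{v₀}(Sel)` under
`inv_{v₀}(· ∪ₑ ·)` (reciprocity: for `x ∈ H¹_{𝓛,⊤ at v₀}` and `s ∈ Sel` every local term of the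
Poitou–Tate sum away from `v₀` vanishes by isotropy, hence so does the one at `v₀`), and
`#N · #loc(Sel) = #H¹(K_{v₀}, E[n]) = #𝓛²` gives `[N : 𝓛] = [𝓛 : loc Sel]`.
[cite: JetchevSkinnerWan2017, Prop. 3.2.1 (proof, arXiv:1512.06894 pp. 10–11)]
[cite: MilneADT2006, Ch. I, Thm. 4.10(b), Cor. 2.3, Thm. 2.8] -/
theorem relIndex_selmerGroup_kummerOutside_le_locIndex (hn2 : 2 ≤ n)
    (inv : LocalInvariants K n) (hperf : inv.IsPerfect) (hPT : inv.SumLocalTermEqZero)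
    (hEuler : Nat.card (galoisCohomology ((W.torsionGaloisModule n).toLocal (Sum.inr v₀)) 1) =
      (Nat.card (nsmulAddMonoidHom n : (W.baseChange (v₀.adicCompletion K)).toAffine.Point →+ _).ker *
        Nat.card (v₀.adicCompletionIntegers K ⧸ Ideal.span {(n : v₀.adicCompletionIntegers K)})) ^ 2) :
    (selmerGroup W (n : ℤ)).relIndex (kummerOutside W n {Sum.inr v₀}) ≤
      ((selmerGroup W (n : ℤ)).map
          (galoisCohomology.localization (W.torsionGaloisModule n) (Sum.inr v₀) 1)).relIndex
        (W.kummerSelmerStructure n (Sum.inr v₀)) := by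
  classical
  haveI : PerfectField K := PerfectField.ofCharZero
  haveI : CharZero (v₀.adicCompletion K) := charZero_adicCompletion v₀
  -- cup products need `Finite E[n]` and the compactness of absolute Galois groups (local instances
  -- of the X11b file `BDPRouteRelaxation`, supplied here inside the proof)
  haveI : Finite (geomTorsion W n) := finite_geomTorsion_of_neZero W n
  haveI : ∀ v : Place K, CompactSpace (absoluteGaloisGroup (Place.Completion v)) := fun v ↦
    absoluteGaloisGroup_compactSpace _
  haveI : CompactSpace (absoluteGaloisGroup K) := absoluteGaloisGroup_compactSpace _
  obtain ⟨e, hμ, hadd₁, hadd₂, halt, hnondeg, hgal⟩ :=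
    exists_weilPairing_holds W n hn2 (by exact_mod_cast NeZero.ne n)
  -- notation
  set M := W.torsionGaloisModule n with hM
  set loc := galoisCohomology.localization M (Sum.inr v₀) 1 with hloc
  set b := invWeilPairing W n e hμ hadd₁ hadd₂ hgal inv (Sum.inr v₀) with hb
  set L := W.kummerSelmerStructure n (Sum.inr v₀) with hL
  set KO := kummerOutside W n {Sum.inr v₀} with hKO
  set Sel := selmerGroup W (n : ℤ) with hSeldef
  set HS := Sel.map loc with hHS
  set N := annLeft b HS with hN
  haveI hfinA : Finite (galoisCohomology (M.toLocal (Sum.inr v₀)) 1) := by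
    change Finite (galoisCohomology (GaloisRep.restrictField (v₀.adicCompletion K) (W.torsionGaloisModule n)) 1)
    exact finite_galoisCohomology_one_of_isNonarchimedeanLocalField _
  -- (1) `Sel = comap L ⊓ KO`
  have hSel : Sel = L.comap loc ⊓ KO := by
    apply le_antisymm
    · intro c hc
      exact ⟨(W.mem_selmerGroup_iff_forall_localization_mem n c).mp hc (Sum.inr v₀),
        selmerGroup_le_kummerOutside W n _ hc⟩
    · rintro c ⟨hc₀, hcKO⟩
      refine mem_selmerGroup_of_mem_kummerOutside W n hcKO fun v => ?_
      obtain ⟨v, hv⟩ := v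
      rw [Finset.mem_singleton] at hv
      subst hv
      exact hc₀
  -- (2) the relative index through `loc`
  have h2' : (L.comap loc ⊓ KO).relIndex KO = L.relIndex (L ⊔ KO.map loc) := by
    rw [AddSubgroup.inf_relIndex_right, AddSubgroup.relIndex_comap, AddSubgroup.relIndex_sup_left]
  have h2 : Sel.relIndex KO = L.relIndex (L ⊔ KO.map loc) := by
    rw [hSel]; exact h2'
  -- (3) `HS ≤ L`, `KO.map loc ≤ N` (reciprocity), `L ≤ N` (isotropy)
  have hHSL : HS ≤ L := by
    rintro _ ⟨s, hs, rfl⟩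
    exact (W.mem_selmerGroup_iff_forall_localization_mem n s).mp hs (Sum.inr v₀)
  have hKON : KO.map loc ≤ N := by
    rintro _ ⟨x, hx, rfl⟩
    rw [hN, mem_annLeft_iff]
    rintro _ ⟨s, hs, rfl⟩
    -- all local terms away from `v₀` vanish by isotropy; Poitou–Tate kills the one at `v₀`
    have hS : ∀ v ∉ ({Sum.inr v₀} : Finset (Place K)),
        inv v ((weilContPairingLocal W n e hμ hadd₁ hadd₂ hgal v).cupProduct
          (galoisCohomology.localization (W.torsionGaloisModule n) v 1 x)
          (galoisCohomology.localization (W.torsionGaloisModule n) v 1 s)) = 0 := by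
      intro v hv
      have hxv : galoisCohomology.localization (W.torsionGaloisModule n) v 1 x ∈
          W.kummerSelmerStructure n v := (mem_kummerOutside_iff W n {Sum.inr v₀} x).mp hx v hv
      have hsv : galoisCohomology.localization (W.torsionGaloisModule n) v 1 s ∈
          W.kummerSelmerStructure n v := (W.mem_selmerGroup_iff_forall_localization_mem n s).mp hs v
      have h := invWeilPairing_eq_zero_of_mem W n e hμ hadd₁ hadd₂ hgal halt inv v hxv hsv
      rwa [invWeilPairing_apply] at h
    have h := sum_inv_weilCupProduct_localization_eq_zero W n e hμ hadd₁ hadd₂ hgal inv hPT x s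
      {Sum.inr v₀} hS
    rw [Finset.sum_singleton] at h
    rw [invWeilPairing_apply]
    exact h
  have hLN : L ≤ N := by
    intro x hx
    rw [hN, mem_annLeft_iff]
    intro y hy
    exact invWeilPairing_eq_zero_of_mem W n e hμ hadd₁ hadd₂ hgal halt inv (Sum.inr v₀) hx (hHSL hy)
  have hXN : L ⊔ KO.map loc ≤ N := sup_le hLN hKON
  -- (4) `[L ⊔ loc KO : L] ≤ [N : L]`
  haveI : Finite N := inferInstance
  have hXNne : (L ⊔ KO.map loc).relIndex N ≠ 0 := AddSubgroup.FiniteIndex.index_ne_zero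
  have h4 : L.relIndex (L ⊔ KO.map loc) ≤ L.relIndex N := by
    have := AddSubgroup.relIndex_mul_relIndex L (L ⊔ KO.map loc) N le_sup_left hXN
    exact Nat.le_of_dvd (Nat.pos_of_ne_zero (by
      rw [← this]; exact mul_ne_zero (by
        intro h0; rw [h0, zero_mul] at this
        exact (AddSubgroup.FiniteIndex.index_ne_zero (H := L.addSubgroupOf N)) this.symm) hXNne))
      (Dvd.intro _ this)
  -- (5) `#N · #HS = #A = #L²`, so `[N : L] = [L : HS]`
  have hA : ∀ x : galoisCohomology (M.toLocal (Sum.inr v₀)) 1, n • x = 0 :=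
    nsmul_continuousCohomology_one_eq_zero _ n (fun T : geomTorsion W n => AddSubgroup.torsionBy.nsmul T)
  have hbij : Bijective b := invWeilPairing_bijective W n e hμ hadd₁ hadd₂ hgal hnondeg inv v₀ (hperf v₀).1.1
  have hNH : Nat.card N * Nat.card HS = Nat.card (galoisCohomology (M.toLocal (Sum.inr v₀)) 1) :=
    natCard_annLeft_mul hA b hbij HS
  have hLcard : Nat.card L = Nat.card (nsmulAddMonoidHom n :
        (W.baseChange (v₀.adicCompletion K)).toAffine.Point →+ _).ker *
      Nat.card (v₀.adicCompletionIntegers K ⧸ Ideal.span {(n : v₀.adicCompletionIntegers K)}) :=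
    W.natCard_kummerSelmerStructure_inr v₀ (NeZero.ne n)
  have hAL : Nat.card (galoisCohomology (M.toLocal (Sum.inr v₀)) 1) = Nat.card L * Nat.card L := by
    rw [hEuler, hLcard, sq]
  have hNL : L.relIndex N * Nat.card L = Nat.card N := by
    rw [AddSubgroup.relIndex, mul_comm, ← Nat.card_congr (AddSubgroup.addSubgroupOfEquivOfLe hLN).toEquiv]
    exact AddSubgroup.card_mul_index _
  have hLH : HS.relIndex L * Nat.card HS = Nat.card L := by
    rw [AddSubgroup.relIndex, mul_comm, ← Nat.card_congr (AddSubgroup.addSubgroupOfEquivOfLe hHSL).toEquiv]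
    exact AddSubgroup.card_mul_index _
  have hLpos : 0 < Nat.card L := Nat.card_pos
  have hHpos : 0 < Nat.card HS := Nat.card_pos
  have h5 : L.relIndex N = HS.relIndex L := by
    have key : L.relIndex N * Nat.card L * Nat.card HS = HS.relIndex L * Nat.card HS * Nat.card L := by
      rw [hNL, hNH, hAL, hLH]
    have : L.relIndex N * (Nat.card L * Nat.card HS) = HS.relIndex L * (Nat.card L * Nat.card HS) := by
      rw [← mul_assoc, key]; ring
    exact Nat.eq_of_mul_eq_mul_right (Nat.mul_pos hLpos hHpos) this
  calc Sel.relIndex KO = L.relIndex (L ⊔ KO.map loc) := h2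
    _ ≤ L.relIndex N := h4
    _ = HS.relIndex L := h5

/-- **The same from the two NAMED FACTS** (Poitou–Tate `poitouTate_sum_localTatePairing_eq_zero K`,
Milne I Thm. 4.10(b)/Cor. 2.3; the local Euler–Poincaré characteristic at `K_{v₀}`,
`localEulerPoincareCharacteristic`, Milne I Thm. 2.8), for a prime power `n`:
`[H¹_{𝓛, ⊤ at v₀}(K, E[n]) : Sel⁽ⁿ⁾(E/K)] ≤ [𝓛_{v₀} : loc_{v₀} Sel⁽ⁿ⁾(E/K)]`.
[cite: JetchevSkinnerWan2017, Prop. 3.2.1 (proof, arXiv:1512.06894 pp. 10–11)]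
[cite: MilneADT2006, Ch. I, Thm. 4.10(b) and Thm. 2.8] -/
theorem relIndex_selmerGroup_kummerOutside_le_locIndex_of_facts (hn : IsPrimePow n)
    (hPT : poitouTate_sum_localTatePairing_eq_zero K)
    (hEP : localEulerPoincareCharacteristic (v₀.adicCompletion K)) :
    (selmerGroup W (n : ℤ)).relIndex (kummerOutside W n {Sum.inr v₀}) ≤
      ((selmerGroup W (n : ℤ)).map
          (galoisCohomology.localization (W.torsionGaloisModule n) (Sum.inr v₀) 1)).relIndex
        (W.kummerSelmerStructure n (Sum.inr v₀)) := by
  obtain ⟨inv, hperf, hsum⟩ := hPT n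
  have hn2 : 2 ≤ n := by
    obtain ⟨p, k, hp, hk, rfl⟩ := hn
    calc 2 ≤ p := (Nat.prime_iff.mpr hp).two_le
      _ = p ^ 1 := (pow_one p).symm
      _ ≤ p ^ k := Nat.pow_le_pow_right (Nat.prime_iff.mpr hp).pos hk
  exact relIndex_selmerGroup_kummerOutside_le_locIndex W n v₀ hn2 inv hperf hsum
    (natCard_galoisCohomology_one_torsion_adicCompletion_eq_sq W v₀ n hn hEP)

end PartB

/-! ## 2. The index of `loc_𝔮 Sel` from the `𝔮`-torsion-valued part and the size of `Sel` -/

section LocIndex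

variable {K : Type} [Field K] [NumberField K] (E : WeierstrassCurve K) [E.IsElliptic]

/-- **`[𝓛_𝔮 : loc_𝔮 Sel⁽ⁿ⁾] ≤ B₃ · B₁`** when the `𝔮`-torsion-valued part of `Sel⁽ⁿ⁾(E/K)` has order
`≤ B₁` and `#𝓛_𝔮 ≤ B₃ · #Sel⁽ⁿ⁾(E/K)`: `[𝓛 : loc Sel] · #Sel = #𝓛 · #ker(loc|Sel)` and the kernel of
`loc_𝔮` on `Sel` lies in the torsion-valued part (`0 = κ_𝔮(0)`). Pure counting. [folklore] -/
theorem locIndex_le_of_torsionValued_of_card (n : ℕ) [NeZero n] (𝔮 : HeightOneSpectrum (𝓞 K))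
    (hn : (n : ℤ) ≠ 0) {B₁ B₃ : ℕ}
    (hB₁ : Nat.card ↥(selmerGroup E (n : ℤ) ⊓
        ((AddCommGroup.torsion (E.baseChange (𝔮.adicCompletion K)).toAffine.Point).map
          (E.localKummerMap (𝔮.adicCompletion K) hn)).comap
          (galoisCohomology.res (E.torsionGaloisModule (n : ℤ)) (𝔮.adicCompletion K) 1)) ≤ B₁)
    (hL : Nat.card (E.kummerSelmerStructure (n : ℤ) (Sum.inr 𝔮)) ≤
      B₃ * Nat.card (selmerGroup E (n : ℤ))) :
    ((selmerGroup E (n : ℤ)).map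
        (galoisCohomology.localization (E.torsionGaloisModule (n : ℤ)) (Sum.inr 𝔮) 1)).relIndex
      (E.kummerSelmerStructure (n : ℤ) (Sum.inr 𝔮)) ≤ B₃ * B₁ := by
  classical
  haveI : CharZero (𝔮.adicCompletion K) := charZero_adicCompletion 𝔮
  set loc := galoisCohomology.localization (E.torsionGaloisModule (n : ℤ)) (Sum.inr 𝔮) 1 with hloc
  set Sel := selmerGroup E (n : ℤ) with hSel
  set L := E.kummerSelmerStructure (n : ℤ) (Sum.inr 𝔮) with hL'
  set HS := Sel.map loc with hHS
  set C := ((AddCommGroup.torsion (E.baseChange (𝔮.adicCompletion K)).toAffine.Point).map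
      (E.localKummerMap (𝔮.adicCompletion K) hn)).comap
    (galoisCohomology.res (E.torsionGaloisModule (n : ℤ)) (𝔮.adicCompletion K) 1) with hC
  haveI hSelfin : Finite Sel := E.finite_selmerGroup_holds hn
  haveI : Finite ↥(Sel ⊓ C) := Finite.of_injective _ (AddSubgroup.inclusion_injective inf_le_left)
  have hHSL : HS ≤ L := by
    rintro _ ⟨s, hs, rfl⟩
    exact (E.mem_selmerGroup_iff_forall_localization_mem n s).mp hs (Sum.inr 𝔮)
  -- `f = loc|Sel`, `#Sel = #ker f · #HS`
  set f : Sel →+ _ := loc.comp Sel.subtype with hf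
  have hrange : f.range = HS := by
    ext y
    constructor
    · rintro ⟨x, rfl⟩
      exact ⟨x.1, x.2, rfl⟩
    · rintro ⟨s, hs, rfl⟩
      exact ⟨⟨s, hs⟩, rfl⟩
  have hcard : Nat.card f.ker * Nat.card HS = Nat.card Sel := by
    rw [← hrange, ← AddSubgroup.index_ker f]
    exact AddSubgroup.card_mul_index f.ker
  -- `ker f ↪ Sel ⊓ C`
  have hker : Nat.card f.ker ≤ B₁ := by
    refine le_trans (Nat.card_le_card_of_injective
      (fun x : f.ker => (⟨x.1.1, x.1.2, ?_⟩ : ↥(Sel ⊓ C))) ?_) hB₁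
    · have hx : loc x.1.1 = 0 := (AddMonoidHom.mem_ker).mp x.2
      have hx' : galoisCohomology.res (E.torsionGaloisModule (n : ℤ)) (𝔮.adicCompletion K) 1 x.1.1 = 0 :=
        hx
      change galoisCohomology.res (E.torsionGaloisModule (n : ℤ)) (𝔮.adicCompletion K) 1 x.1.1 ∈
        ((AddCommGroup.torsion (E.baseChange (𝔮.adicCompletion K)).toAffine.Point).map
          (E.localKummerMap (𝔮.adicCompletion K) hn))
      rw [hx']
      exact zero_mem _
    · intro x y hxy
      have h := congrArg Subtype.val hxy
      exact Subtype.ext (Subtype.ext h)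
  -- `[L : HS] · #HS = #L`
  have hLH : HS.relIndex L * Nat.card HS = Nat.card L := by
    rw [AddSubgroup.relIndex, mul_comm, ← Nat.card_congr (AddSubgroup.addSubgroupOfEquivOfLe hHSL).toEquiv]
    exact AddSubgroup.card_mul_index _
  have hSelpos : 0 < Nat.card Sel := Nat.card_pos
  -- `[L : HS] · #Sel = #L · #ker f ≤ B₃ #Sel · B₁`
  have hkey : HS.relIndex L * Nat.card Sel ≤ B₃ * B₁ * Nat.card Sel := by
    calc HS.relIndex L * Nat.card Sel = HS.relIndex L * Nat.card HS * Nat.card f.ker := by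
          rw [← hcard]; ring
      _ = Nat.card L * Nat.card f.ker := by rw [hLH]
      _ ≤ B₃ * Nat.card Sel * B₁ := Nat.mul_le_mul hL hker
      _ = B₃ * B₁ * Nat.card Sel := by ring
  exact Nat.le_of_mul_le_mul_right hkey hSelpos

end LocIndex

end Summit.BirchSwinnertonDyer.BirchSwinnertonDyer.Theorems.CongruentShaFreeCutTwoAdicSelmerLocIndex

end
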